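import Summits.BirchSwinnertonDyer.BirchSwinnertonDyer.Theorems.ByReductionTypeAtTwoFineSelmerConjAAtTwoAdditivePotGoodNarrowRankCertificate316LayerOne
import Summits.BirchSwinnertonDyer.BirchSwinnertonDyer.Theorems.ByReductionTypeAtTwoFineSelmerConjAAtTwoAdditivePotGoodNarrowRankCertificate63644LayerParity
import Literature.NumberTheory.NumberFields.DyadicUnitSquaresRamifiedPrime
import HarnessLib

/-!
# Route `ByReductionTypeAtTwo` (rung K4), crux C1″ `FineSelmerConjAAtTwoAdditivePotGood` (item stmt-BirchSwinnertonDyer-22615):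
# THE LAYER-`1` FIELD `A₁ = ℚ(θ) ⊔ ℚ_1 = ℚ(θ, √2)` OF THE CUBIC FIELD OF DISCRIMINANT `316`, PART B — the integers `θ`, `ξ = √2/θ`, the two
# dyadic primes `(ξ)`, `(1 + ξ)` (`2 = v·ξ²(1+ξ)⁴`) and the parity of `h(A₁)` (KERNEL)
# (a `--supports 22615` file; seat `bsd-2adic-k4-w1` GEN 11; sequel of `…316LayerOne`; row `261648q1`, narrow-rank certificate one layer up)

HONEST FRAMING (cell `bsd-2adic`, D-0036/D-0054/D-0152): KERNEL theorems about ONE totally real sextic field; no elliptic curve, no named fact,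
no `sorry`, no definition. Closes nothing at the `∀`-level; nothing booked; BSD is not proved by any of this.

THE ARITHMETIC (`b = θ`, `t = √2 ∈ ℚ_1`).  `ξ = t(4 + b − b²)/2` has `ξ·b = t` and `ξ² = 9 + b − 2b²`, so `ξ ∈ 𝓞 A₁` (`𝓞 A₁ = ℤ[b, ξ]` by
discriminants, not needed here); `2 = ξ²b²`; `|N(b)| = 4` in `A₁` (norm transitivity: `= N_{ℚ(θ)}(θ)²`), `b = v'(1 + ξ)²` and
`2 = v ξ²(1 + ξ)⁴` with units `v, v'`, whence `|N(1 + ξ)| = 2 = |N(ξ)|`: `(ξ)` and `(1 + ξ)` are the prime ideals above `2` (degree one;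
`e((ξ)|2) = 2`, `e((1+ξ)|2) = 4`), `ξ` is a prime element with residues `{0, 1}`, `ξ ∤ b²`, `ξ ∤ μ = b + b²ξ` (`ξμ = 2 + t`).  Genus theory
(`AmbiguousClass.odd_classNumber_…`, GEN 10) with the non-norm unit `ε = 3 + b − b²` of `…316Cubic` gives `h(A₁)` odd.  The identities also record,
for the sequel files, `ξ⁴ ‖ ε − 1` and the residues of `u₊ = −1 + 2b + 2b² + ξ(−2 + 3b + 3b²)` modulo `ξ⁵`.
* `layer_one_ids_d316` — the ring identities of `ℤ[b, ξ]` (any commutative ring); `norm_two_eq_sixtyfour`.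
* `layer_one_dyadic_d316` — integers `b, ξ, t` of `𝓞 A₁` with their values and relations; `Prime ξ`, residues `{0,1}`, `ξ ∤ b²`, `ξ ∤ μ`,
  `(ξ)`, `(1+ξ)` prime, `2 = vξ²(1+ξ)⁴` with `v` a unit.
* `odd_classNumber_adjoin_sup_layer_one_d316` — `h(A₁)` odd.

References: [Omeara1963] §63A–B; [Lang1990] Ch. 13 §4 Lemma 4.1; [Cohen1993] §4.8.2, §6.3; [Washington1997] §13.1; [Marcus1977] Ch. 3 Thm. 22.
-/

set_option autoImplicit false
-- sibling precedent: the directory name repeats the summit name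
set_option linter.dupNamespace false

noncomputable section

open scoped Classical IntermediateField NumberField nonZeroDivisors

namespace Summit.BirchSwinnertonDyer.BirchSwinnertonDyer.Theorems.AddKatoTwo

open Polynomial IsDedekindDomain NumberField Field IntermediateField
  Literature.NumberTheory.EllipticCurves Literature.NumberTheory.EllipticCurves.ZpExtension
  Literature.NumberTheory.IwasawaTheory Literature.NumberTheory.NumberFields
  Literature.NumberTheory.GaloisRepresentations Literature.Geometry.Kaehler.ComplexTorus

/-! ## §1 The ring identities of `ℤ[b, ξ]` -/

/-- **The identities of `ℤ[θ, ξ]`, `θ³ − θ² − 4θ + 2 = 0`, `ξ² = 9 + θ − 2θ²`**, in any commutative ring (`μ = b + b²ξ`, `ε = 3 + b − b²`,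
`u₊ = −1 + 2b + 2b² + ξ(−2 + 3b + 3b²)`, `v' = b/(1+ξ)²`, `v = 2/(ξ²(1+ξ)⁴)` and their inverses). [folklore] [cite: Cohen1993, §4.8.2 and §6.3] -/
theorem layer_one_ids_d316 {R : Type*} [CommRing R] (b x : R) (Rb : b ^ 3 - b ^ 2 - 4 * b + 2 = 0) (Rx : x ^ 2 = 9 + b - 2 * b ^ 2) :
    x ^ 2 * b ^ 2 = 2 ∧
    b ^ 2 - 1 = x * (-x + b * x + 2 * b ^ 2 * x) ∧
    (b + b ^ 2 * x) - 1 = x * (-x + 2 * b * x + b ^ 2) ∧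
    x * (b + b ^ 2 * x) = 2 + b * x ∧
    (3 + b - b ^ 2) - 1 = x ^ 4 * (b - 2 * b ^ 2) ∧
    (b - 2 * b ^ 2) - 1 = x * (x - 5 * b ^ 2 * x) ∧
    (-1 + 2 * b + 2 * b ^ 2 + x * (-2 + 3 * b + 3 * b ^ 2)) - 1 =
      x ^ 2 * (1 + x * (-6 - 11 * x + 9 * b + 17 * b * x + 8 * b ^ 2 + 13 * b ^ 2 * x)) ∧
    (-1 + 2 * b + 2 * b ^ 2 + x * (-2 + 3 * b + 3 * b ^ 2)) - (1 + x ^ 2 + x ^ 3 * b ^ 2) =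
      x ^ 4 * (1 + x * (-16 - 30 * x + 25 * b + 47 * b * x + 19 * b ^ 2 + 35 * b ^ 2 * x)) ∧
    (-1 + 2 * b + 2 * b ^ 2 + x * (-2 + 3 * b + 3 * b ^ 2)) - 1 = x * (-2 - 4 * x + 3 * b + 6 * b * x + 3 * b ^ 2 + 5 * b ^ 2 * x) ∧
    (-1 + 2 * b + 2 * b ^ 2 + x * (-2 + 3 * b + 3 * b ^ 2)) * (5 - 2 * x - 2 * b + 3 * b * x - b ^ 2 * x) = 1 ∧
    b = (-3 + 4 * x + 7 * b - 9 * b * x - b ^ 2 + b ^ 2 * x) * (1 + x) ^ 2 ∧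
    (-3 + 4 * x + 7 * b - 9 * b * x - b ^ 2 + b ^ 2 * x) * (21 + 4 * x + 3 * b + b * x - 5 * b ^ 2 - b ^ 2 * x) = 1 ∧
    (69 - 84 * x - 188 * b + 234 * b * x + 88 * b ^ 2 - 118 * b ^ 2 * x) * x ^ 2 * (1 + x) ^ 4 = 2 ∧
    (69 - 84 * x - 188 * b + 234 * b * x + 88 * b ^ 2 - 118 * b ^ 2 * x) * (613 + 180 * x + 76 * b + 22 * b * x - 144 * b ^ 2 - 42 * b ^ 2 * x) = 1 := by
  refine ⟨?_, ?_, ?_, ?_, ?_, ?_, ?_, ?_, ?_, ?_, ?_, ?_, ?_, ?_⟩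
  · linear_combination ((-1 : R) + (-2 : R) * b) * Rb + ((1 : R) * b ^ 2) * Rx
  · linear_combination ((4 : R) + (4 : R) * b) * Rb + ((1 : R) + (-1 : R) * b + (-2 : R) * b ^ 2) * Rx
  · linear_combination ((4 : R)) * Rb + ((1 : R) + (-2 : R) * b) * Rx
  · linear_combination ((-1 : R) + (-2 : R) * b) * Rb + ((1 : R) * b ^ 2) * Rx
  · linear_combination ((1 : R) + (-2 : R) * b + (-4 : R) * b * x ^ 2) * Rb + ((-1 : R) * b + (1 : R) * b ^ 2 + (-1 : R) * b * x ^ 2 + (2 : R) * b ^ 2 * x ^ 2) * Rx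
  · linear_combination ((-5 : R) + (-10 : R) * b) * Rb + ((-1 : R) + (5 : R) * b ^ 2) * Rx
  · linear_combination ((17 : R) + (26 : R) * x + (10 : R) * b + (47 : R) * x ^ 2 + (16 : R) * b * x + (26 : R) * b * x ^ 2) * Rb + ((4 : R) + (6 : R) * x + (-6 : R) * b + (11 : R) * x ^ 2 + (-9 : R) * b * x + (-5 : R) * b ^ 2 + (-17 : R) * b * x ^ 2 + (-8 : R) * b ^ 2 * x + (-13 : R) * b ^ 2 * x ^ 2) * Rx
  · linear_combination ((17 : R) + (26 : R) * x + (10 : R) * b + (47 : R) * x ^ 2 + (16 : R) * b * x + (69 : R) * x ^ 3 + (26 : R) * b * x ^ 2 + (129 : R) * x ^ 4 + (38 : R) * b * x ^ 3 + (70 : R) * b * x ^ 4) * Rb + ((4 : R) + (6 : R) * x + (-6 : R) * b + (11 : R) * x ^ 2 + (-9 : R) * b * x + (-5 : R) * b ^ 2 + (16 : R) * x ^ 3 + (-17 : R) * b * x ^ 2 + (-8 : R) * b ^ 2 * x + (30 : R) * x ^ 4 + (-25 : R) * b * x ^ 3 + (-13 : R) * b ^ 2 * x ^ 2 + (-47 :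 R) * b * x ^ 4 + (-19 : R) * b ^ 2 * x ^ 3 + (-35 : R) * b ^ 2 * x ^ 4) * Rx
  · linear_combination ((17 : R) + (10 : R) * b) * Rb + ((4 : R) + (-6 : R) * b + (-5 : R) * b ^ 2) * Rx
  · linear_combination ((-12 : R) + (-4 : R) * x + (8 : R) * b + (3 : R) * x ^ 2 + (-2 : R) * b * x + (-3 : R) * b * x ^ 2) * Rb + ((-2 : R) + (6 : R) * b + (-4 : R) * b ^ 2) * Rx
  · linear_combination ((-21 : R) + (-17 : R) * x + (2 : R) * b + (2 : R) * b * x) * Rb + ((-5 : R) + (-4 : R) * x + (11 : R) * b + (9 : R) * b * x + (-1 : R) * b ^ 2 + (-1 : R) * b ^ 2 * x) * Rx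
  · linear_combination ((-41 : R) + (36 : R) * x + (13 : R) * b + (9 : R) * x ^ 2 + (-4 : R) * b * x + (-1 : R) * b * x ^ 2) * Rb + ((-2 : R) + (6 : R) * b + (-4 : R) * b ^ 2) * Rx
  · linear_combination ((-1 : R) + (-2 : R) * b + (-420 : R) * x ^ 2 + (-1182 : R) * x ^ 3 + (316 : R) * b * x ^ 2 + (-1112 : R) * x ^ 4 + (844 : R) * b * x ^ 3 + (-350 : R) * x ^ 5 + (768 : R) * b * x ^ 4 + (236 : R) * b * x ^ 5) * Rb + ((-101 : R) * x ^ 2 + (1 : R) * b ^ 2 + (-284 : R) * x ^ 3 + (289 : R) * b * x ^ 2 + (-267 : R) * x ^ 4 + (802 : R) * b * x ^ 3 + (-158 : R) * b ^ 2 * x ^ 2 + (-84 : R) * x ^ 5 + (748 : R) * b * x ^ 4 + (-422 : R) * b ^ 2 * x ^ 3 + (234 : R) * b * x ^ 5 + (-384 : R) * b ^ 2 * x ^ 4 + (-118 : R) * b ^ 2 * x ^ 5) * Rx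
  · linear_combination ((20320 : R) + (-19536 : R) * x + (-12256 : R) * b + (-7468 : R) * x ^ 2 + (13296 : R) * b * x + (4956 : R) * b * x ^ 2) * Rb + ((-184 : R) + (488 : R) * b + (-208 : R) * b ^ 2) * Rx

/-! ## §2 The integers `b`, `ξ`, `t` of `A₁` and the dyadic primes -/

variable {θ : AlgebraicClosure ℚ}

/-- `N(2) = 64` in a sextic number field (`N(n) = n⁶`). [cite: Marcus1977, Ch. 2 Thm. 4] -/
theorem norm_two_eq_sixtyfour {L : Type} [Field L] [NumberField L] (h6 : Module.finrank ℚ L = 6) :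
    Algebra.norm ℤ (2 : 𝓞 L) = 64 := by
  have h := Algebra.norm_algebraMap (S := 𝓞 L) (2 : ℤ)
  rw [NumberField.RingOfIntegers.rank, h6] at h
  simpa using h

set_option maxHeartbeats 800000 in
/-- **The integers `b = θ`, `ξ = √2/θ`, `t = √2` of `A₁ = ℚ(θ) ⊔ ℚ_1` (`θ³ − θ² − 4θ + 2 = 0`) and the dyadic primes of `A₁`**: `ξ b = t`,
`ξ² = 9 + b − 2b²`, `t² = 2`; `ξ` is a PRIME ELEMENT (`|N(ξ)| = 2`) with residues `{0, 1}`, `ξ ∤ b²`, `ξ ∤ μ` (`e((ξ)|2) = 2`, `f = 1`); `(ξ)`,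
`(1 + ξ)` are prime ideals and `2 = v ξ² (1 + ξ)⁴` with `v` a unit (ALL the primes of `A₁` above `2`). KERNEL. [cite: Cohen1993, §4.8.2 and §6.3]
[cite: Marcus1977, Ch. 3 Thm. 22] [cite: Washington1997, §13.1] -/
theorem layer_one_dyadic_d316 (hθ : aeval θ (Cubic.toPoly ⟨1, ((-1 : ℤ) : ℚ), ((-4 : ℤ) : ℚ), ((2 : ℤ) : ℚ)⟩) = 0)
    {t : AlgebraicClosure ℚ} (ht : t ∈ (CyclotomicZp.zpExtension 2).layer 1) (ht2 : t ^ 2 = 2) :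
    haveI : FiniteDimensional ℚ ↥ℚ⟮θ⟯ :=
      IntermediateField.adjoin.finiteDimensional ⟨_, Cubic.monic_of_a_eq_one', by rwa [← aeval_def]⟩
    haveI : FiniteDimensional ℚ ↥((CyclotomicZp.zpExtension 2).layer 1) := (CyclotomicZp.zpExtension 2).finiteDimensional_layer_holds 1
    ∃ bA xA sA v : 𝓞 ↥(ℚ⟮θ⟯ ⊔ (CyclotomicZp.zpExtension 2).layer 1),
      (bA : ↥(ℚ⟮θ⟯ ⊔ (CyclotomicZp.zpExtension 2).layer 1)) =
          inclusion (le_sup_left : ℚ⟮θ⟯ ≤ ℚ⟮θ⟯ ⊔ (CyclotomicZp.zpExtension 2).layer 1) (AdjoinSimple.gen ℚ θ) ∧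
      (sA : ↥(ℚ⟮θ⟯ ⊔ (CyclotomicZp.zpExtension 2).layer 1)) = ⟨t, (le_sup_right : (CyclotomicZp.zpExtension 2).layer 1 ≤ _) ht⟩ ∧
      (xA : ↥(ℚ⟮θ⟯ ⊔ (CyclotomicZp.zpExtension 2).layer 1)) *
          inclusion (le_sup_left : ℚ⟮θ⟯ ≤ ℚ⟮θ⟯ ⊔ (CyclotomicZp.zpExtension 2).layer 1) (AdjoinSimple.gen ℚ θ) =
        ⟨t, (le_sup_right : (CyclotomicZp.zpExtension 2).layer 1 ≤ _) ht⟩ ∧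
      bA ^ 3 - bA ^ 2 - 4 * bA + 2 = 0 ∧ xA ^ 2 = 9 + bA - 2 * bA ^ 2 ∧ bA * xA = sA ∧ sA ^ 2 = 2 ∧
      Prime xA ∧ (∀ z : 𝓞 ↥(ℚ⟮θ⟯ ⊔ (CyclotomicZp.zpExtension 2).layer 1), xA ∣ z ∨ xA ∣ z - 1) ∧ ¬ xA ∣ bA ^ 2 ∧
      ¬ xA ∣ (bA + bA ^ 2 * xA) ∧ (Ideal.span {xA}).IsPrime ∧ (Ideal.span {1 + xA}).IsPrime ∧ IsUnit v ∧
      v * xA ^ 2 * (1 + xA) ^ 4 = 2 := by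
  haveI : FiniteDimensional ℚ ↥ℚ⟮θ⟯ :=
    IntermediateField.adjoin.finiteDimensional ⟨_, Cubic.monic_of_a_eq_one', by rwa [← aeval_def]⟩
  haveI : FiniteDimensional ℚ ↥((CyclotomicZp.zpExtension 2).layer 1) := (CyclotomicZp.zpExtension 2).finiteDimensional_layer_holds 1
  haveI : NumberField ↥ℚ⟮θ⟯ := NumberField.mk
  haveI : NumberField ↥(ℚ⟮θ⟯ ⊔ (CyclotomicZp.zpExtension 2).layer 1) := NumberField.mk
  obtain ⟨-, hfinA, h3⟩ := layer_one_basics_d316 hθ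
  have hKA : ℚ⟮θ⟯ ≤ ℚ⟮θ⟯ ⊔ (CyclotomicZp.zpExtension 2).layer 1 := le_sup_left
  have htA : t ∈ ℚ⟮θ⟯ ⊔ (CyclotomicZp.zpExtension 2).layer 1 := (le_sup_right : (CyclotomicZp.zpExtension 2).layer 1 ≤ _) ht
  set t' : ↥(ℚ⟮θ⟯ ⊔ (CyclotomicZp.zpExtension 2).layer 1) := ⟨t, htA⟩ with ht'def
  have ht'2 : t' ^ 2 = 2 := by
    apply (algebraMap ↥(ℚ⟮θ⟯ ⊔ (CyclotomicZp.zpExtension 2).layer 1) (AlgebraicClosure ℚ)).injective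
    rw [map_pow, map_ofNat]
    exact ht2
  letI : Algebra ↥ℚ⟮θ⟯ ↥(ℚ⟮θ⟯ ⊔ (CyclotomicZp.zpExtension 2).layer 1) := (inclusion hKA).toRingHom.toAlgebra
  have halg : ∀ c : ↥ℚ⟮θ⟯, algebraMap ↥ℚ⟮θ⟯ ↥(ℚ⟮θ⟯ ⊔ (CyclotomicZp.zpExtension 2).layer 1) c = inclusion hKA c := fun _ => rfl
  haveI : IsScalarTower ℚ ↥ℚ⟮θ⟯ ↥(ℚ⟮θ⟯ ⊔ (CyclotomicZp.zpExtension 2).layer 1) :=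
    IsScalarTower.of_algebraMap_eq fun q => ((inclusion hKA).commutes q).symm
  haveI : Module.Finite ↥ℚ⟮θ⟯ ↥(ℚ⟮θ⟯ ⊔ (CyclotomicZp.zpExtension 2).layer 1) := Module.Finite.of_restrictScalars_finite ℚ ↥ℚ⟮θ⟯ _
  have hdeg : Module.finrank ↥ℚ⟮θ⟯ ↥(ℚ⟮θ⟯ ⊔ (CyclotomicZp.zpExtension 2).layer 1) = 2 := by
    have htower := Module.finrank_mul_finrank ℚ ↥ℚ⟮θ⟯ ↥(ℚ⟮θ⟯ ⊔ (CyclotomicZp.zpExtension 2).layer 1)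
    rw [h3, hfinA] at htower
    omega
  obtain ⟨b, hbθ, hb⟩ := exists_ringOfIntegers_cubic_root (p := -1) (q := -4) (r := 2) hθ
  have hb' : b ^ 3 - b ^ 2 - 4 * b + 2 = 0 := by push_cast at hb; linear_combination hb
  have hbgen : algebraMap (𝓞 ↥ℚ⟮θ⟯) ↥ℚ⟮θ⟯ b = AdjoinSimple.gen ℚ θ := Subtype.ext hbθ
  set θ' : ↥(ℚ⟮θ⟯ ⊔ (CyclotomicZp.zpExtension 2).layer 1) := inclusion hKA (AdjoinSimple.gen ℚ θ) with hθ'def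
  set bA : 𝓞 ↥(ℚ⟮θ⟯ ⊔ (CyclotomicZp.zpExtension 2).layer 1) :=
    algebraMap (𝓞 ↥ℚ⟮θ⟯) (𝓞 ↥(ℚ⟮θ⟯ ⊔ (CyclotomicZp.zpExtension 2).layer 1)) b with hbAdef
  have RbA : bA ^ 3 - bA ^ 2 - 4 * bA + 2 = 0 := by
    have h := congrArg (algebraMap (𝓞 ↥ℚ⟮θ⟯) (𝓞 ↥(ℚ⟮θ⟯ ⊔ (CyclotomicZp.zpExtension 2).layer 1))) hb'
    simp only [map_add, map_sub, map_mul, map_pow, map_ofNat, map_zero] at h; exact h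
  have hbAval : algebraMap (𝓞 ↥(ℚ⟮θ⟯ ⊔ (CyclotomicZp.zpExtension 2).layer 1)) ↥(ℚ⟮θ⟯ ⊔ (CyclotomicZp.zpExtension 2).layer 1) bA = θ' := by
    rw [hbAdef, hθ'def, ← IsScalarTower.algebraMap_apply,
      IsScalarTower.algebraMap_apply (𝓞 ↥ℚ⟮θ⟯) ↥ℚ⟮θ⟯ ↥(ℚ⟮θ⟯ ⊔ (CyclotomicZp.zpExtension 2).layer 1), hbgen, halg]
  have hbAval' : (bA : ↥(ℚ⟮θ⟯ ⊔ (CyclotomicZp.zpExtension 2).layer 1)) = θ' := hbAval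
  have hθ'rel : θ' ^ 3 - θ' ^ 2 - 4 * θ' + 2 = 0 := by
    have h := congrArg (algebraMap (𝓞 ↥(ℚ⟮θ⟯ ⊔ (CyclotomicZp.zpExtension 2).layer 1)) ↥(ℚ⟮θ⟯ ⊔ (CyclotomicZp.zpExtension 2).layer 1)) RbA
    simp only [map_add, map_sub, map_mul, map_pow, map_ofNat, map_zero, hbAval] at h; exact h
  set ξ' : ↥(ℚ⟮θ⟯ ⊔ (CyclotomicZp.zpExtension 2).layer 1) := t' * (4 + θ' - θ' ^ 2) / 2 with hξ'def
  have hξθ : ξ' * θ' = t' := by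
    rw [hξ'def]; field_simp; linear_combination (-t') * hθ'rel
  have hξsq : ξ' ^ 2 = 9 + θ' - 2 * θ' ^ 2 := by
    rw [hξ'def]; field_simp
    linear_combination ((4 + θ' - θ' ^ 2) ^ 2) * ht'2 + (2 * (θ' - 1)) * hθ'rel
  have hcoe9 : algebraMap (𝓞 ↥(ℚ⟮θ⟯ ⊔ (CyclotomicZp.zpExtension 2).layer 1)) ↥(ℚ⟮θ⟯ ⊔ (CyclotomicZp.zpExtension 2).layer 1)
      (9 + bA - 2 * bA ^ 2) = 9 + θ' - 2 * θ' ^ 2 := by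
    simp only [map_add, map_sub, map_mul, map_pow, map_ofNat, hbAval]
  have hξint : IsIntegral ℤ ξ' := by
    refine IsIntegral.of_pow two_pos ?_
    rw [hξsq, ← hcoe9]
    exact NumberField.RingOfIntegers.isIntegral_coe _
  set xA : 𝓞 ↥(ℚ⟮θ⟯ ⊔ (CyclotomicZp.zpExtension 2).layer 1) := ⟨ξ', hξint⟩ with hxAdef
  have hxAval : algebraMap (𝓞 ↥(ℚ⟮θ⟯ ⊔ (CyclotomicZp.zpExtension 2).layer 1)) ↥(ℚ⟮θ⟯ ⊔ (CyclotomicZp.zpExtension 2).layer 1) xA = ξ' := rfl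
  have RxA : xA ^ 2 = 9 + bA - 2 * bA ^ 2 := by
    apply NumberField.RingOfIntegers.coe_injective
    rw [map_pow, hxAval, hcoe9, hξsq]
  have hsint : IsIntegral ℤ t' := ⟨X ^ 2 - C 2, monic_X_pow_sub_C _ two_ne_zero, by simp [ht'2]⟩
  set sA : 𝓞 ↥(ℚ⟮θ⟯ ⊔ (CyclotomicZp.zpExtension 2).layer 1) := ⟨t', hsint⟩ with hsAdef
  have hsAval : algebraMap (𝓞 ↥(ℚ⟮θ⟯ ⊔ (CyclotomicZp.zpExtension 2).layer 1)) ↥(ℚ⟮θ⟯ ⊔ (CyclotomicZp.zpExtension 2).layer 1) sA = t' := rfl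
  have hs : bA * xA = sA := by
    apply NumberField.RingOfIntegers.coe_injective
    rw [map_mul, hbAval, hxAval, hsAval, mul_comm, hξθ]
  have hsA2 : sA ^ 2 = 2 := by
    apply NumberField.RingOfIntegers.coe_injective
    rw [map_pow, hsAval, ht'2, map_ofNat]
  obtain ⟨htwo, hkap, hkap', -, -, -, -, -, -, -, hbv', hv'inv, hv2, hv2inv⟩ := layer_one_ids_d316 bA xA RbA RxA
  -- norms: `|N(b)| = 2` in `ℚ(θ)`, `N(bA) = 4` in `A₁`
  have hNb : (Algebra.norm ℤ b).natAbs = 2 := by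
    have hN := natAbs_norm_coords_eq_natAbs_normPoly ↥ℚ⟮θ⟯ h3 b (p := -1) (q := -4) (r := 2) irreducible_cubic_d316p hb 0 1 0
    have he : (((0 : ℤ) : 𝓞 ↥ℚ⟮θ⟯) + ((1 : ℤ) : 𝓞 ↥ℚ⟮θ⟯) * b + ((0 : ℤ) : 𝓞 ↥ℚ⟮θ⟯) * b ^ 2) = b := by push_cast; ring
    rw [he] at hN; rw [hN]; norm_num
  haveI : Module.Free ↥ℚ⟮θ⟯ ↥(ℚ⟮θ⟯ ⊔ (CyclotomicZp.zpExtension 2).layer 1) := Module.Free.of_divisionRing _ _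
  have hNbA : (Algebra.norm ℤ bA).natAbs = 4 := by
    have hgA : (bA : ↥(ℚ⟮θ⟯ ⊔ (CyclotomicZp.zpExtension 2).layer 1)) =
        algebraMap ↥ℚ⟮θ⟯ ↥(ℚ⟮θ⟯ ⊔ (CyclotomicZp.zpExtension 2).layer 1) (AdjoinSimple.gen ℚ θ) := hbAval'.trans (halg _).symm
    have h2 : Algebra.norm ℚ (algebraMap ↥ℚ⟮θ⟯ ↥(ℚ⟮θ⟯ ⊔ (CyclotomicZp.zpExtension 2).layer 1) (AdjoinSimple.gen ℚ θ)) =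
        (Algebra.norm ℚ (AdjoinSimple.gen ℚ θ)) ^ 2 := by
      rw [← Algebra.norm_norm (R := ℚ) (S := ↥ℚ⟮θ⟯)
        (a := algebraMap ↥ℚ⟮θ⟯ ↥(ℚ⟮θ⟯ ⊔ (CyclotomicZp.zpExtension 2).layer 1) (AdjoinSimple.gen ℚ θ)),
        Algebra.norm_algebraMap, hdeg, map_pow]
    have h3' : Algebra.norm ℚ (AdjoinSimple.gen ℚ θ) = (Algebra.norm ℤ b : ℚ) := by
      rw [Algebra.coe_norm_int, ← hbgen]
    have h1 : (Algebra.norm ℤ bA : ℚ) = ((Algebra.norm ℤ b) ^ 2 : ℤ) := by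
      rw [Algebra.coe_norm_int, hgA, h2, h3']; push_cast; ring
    have h4 : Algebra.norm ℤ bA = (Algebra.norm ℤ b) ^ 2 := by exact_mod_cast h1
    rw [h4, Int.natAbs_pow, hNb]
  -- `|N(1 + ξ)| = 2` from `b = v'(1 + ξ)²`, then `|N(ξ)| = 2` from `2 = v ξ² (1 + ξ)⁴`
  set v' : 𝓞 ↥(ℚ⟮θ⟯ ⊔ (CyclotomicZp.zpExtension 2).layer 1) := -3 + 4 * xA + 7 * bA - 9 * bA * xA - bA ^ 2 + bA ^ 2 * xA with hv'def
  set v : 𝓞 ↥(ℚ⟮θ⟯ ⊔ (CyclotomicZp.zpExtension 2).layer 1) :=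
    69 - 84 * xA - 188 * bA + 234 * bA * xA + 88 * bA ^ 2 - 118 * bA ^ 2 * xA with hvdef
  have hv'unit : IsUnit v' := IsUnit.of_mul_eq_one _ hv'inv
  have hvunit : IsUnit v := IsUnit.of_mul_eq_one _ hv2inv
  have hNunit : ∀ {u : 𝓞 ↥(ℚ⟮θ⟯ ⊔ (CyclotomicZp.zpExtension 2).layer 1)}, IsUnit u → (Algebra.norm ℤ u).natAbs = 1 :=
    fun hu => Int.natAbs_of_isUnit (hu.map _)
  have hNψ : (Algebra.norm ℤ (1 + xA)).natAbs = 2 := by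
    have h : (Algebra.norm ℤ (v' * (1 + xA) ^ 2)).natAbs = 4 := by rw [← hbv']; exact hNbA
    rw [map_mul, map_pow, Int.natAbs_mul, Int.natAbs_pow, hNunit hv'unit, one_mul] at h
    have hc : (Algebra.norm ℤ (1 + xA)).natAbs ≤ 2 := by nlinarith [h]
    obtain h0 | h0 | h0 : (Algebra.norm ℤ (1 + xA)).natAbs = 0 ∨ (Algebra.norm ℤ (1 + xA)).natAbs = 1 ∨
        (Algebra.norm ℤ (1 + xA)).natAbs = 2 := by omega
    · rw [h0] at h; norm_num at h
    · rw [h0] at h; norm_num at h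
    · exact h0
  have hNξ : (Algebra.norm ℤ xA).natAbs = 2 := by
    have h : (Algebra.norm ℤ (v * xA ^ 2 * (1 + xA) ^ 4)).natAbs = 64 := by rw [hv2, norm_two_eq_sixtyfour hfinA]; rfl
    rw [map_mul, map_mul, map_pow, map_pow, Int.natAbs_mul, Int.natAbs_mul, Int.natAbs_pow, Int.natAbs_pow, hNunit hvunit,
      one_mul, hNψ] at h
    have hc : (Algebra.norm ℤ xA).natAbs ≤ 2 := by nlinarith [h]
    obtain h0 | h0 | h0 : (Algebra.norm ℤ xA).natAbs = 0 ∨ (Algebra.norm ℤ xA).natAbs = 1 ∨ (Algebra.norm ℤ xA).natAbs = 2 := by omega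
    · rw [h0] at h; norm_num at h
    · rw [h0] at h; norm_num at h
    · exact h0
  have habsξ : Ideal.absNorm (Ideal.span {xA}) = 2 := by rw [Ideal.absNorm_span_singleton, hNξ]
  have habsψ : Ideal.absNorm (Ideal.span {1 + xA}) = 2 := by rw [Ideal.absNorm_span_singleton, hNψ]
  have hPξ : (Ideal.span {xA}).IsPrime := Ideal.isPrime_of_irreducible_absNorm (by rw [habsξ]; exact Nat.prime_two)
  have hPψ : (Ideal.span {1 + xA}).IsPrime := Ideal.isPrime_of_irreducible_absNorm (by rw [habsψ]; exact Nat.prime_two)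
  have hξ0 : xA ≠ 0 := by
    intro h0; rw [h0, Algebra.norm_zero] at hNξ; norm_num at hNξ
  have hprime : Prime xA := (Ideal.span_singleton_prime hξ0).mp hPξ
  have hcard : Nat.card (𝓞 ↥(ℚ⟮θ⟯ ⊔ (CyclotomicZp.zpExtension 2).layer 1) ⧸ Ideal.span {xA}) = 2 := by
    rw [← Submodule.cardQuot_apply, ← Ideal.absNorm_apply, habsξ]
  have hres : ∀ z : 𝓞 ↥(ℚ⟮θ⟯ ⊔ (CyclotomicZp.zpExtension 2).layer 1), xA ∣ z ∨ xA ∣ z - 1 := by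
    intro z
    by_cases hz : Ideal.Quotient.mk (Ideal.span {xA}) z = 0
    · exact Or.inl (Ideal.mem_span_singleton.mp (Ideal.Quotient.eq_zero_iff_mem.mp hz))
    · right
      have h10 : (1 : 𝓞 ↥(ℚ⟮θ⟯ ⊔ (CyclotomicZp.zpExtension 2).layer 1) ⧸ Ideal.span {xA}) ≠ 0 := by
        haveI : Nontrivial (𝓞 ↥(ℚ⟮θ⟯ ⊔ (CyclotomicZp.zpExtension 2).layer 1) ⧸ Ideal.span {xA}) :=
          Ideal.Quotient.nontrivial_iff.mpr hPξ.ne_top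
        exact one_ne_zero
      obtain ⟨y, -, huniq⟩ := (Nat.card_eq_two_iff' (0 : 𝓞 ↥(ℚ⟮θ⟯ ⊔ (CyclotomicZp.zpExtension 2).layer 1) ⧸ Ideal.span {xA})).mp hcard
      have h1 : Ideal.Quotient.mk (Ideal.span {xA}) z = 1 := (huniq _ hz).trans (huniq _ h10).symm
      have h0 : Ideal.Quotient.mk (Ideal.span {xA}) (z - 1) = 0 := by rw [map_sub, h1, map_one, sub_self]
      exact Ideal.mem_span_singleton.mp (Ideal.Quotient.eq_zero_iff_mem.mp h0)
  have hone : ∀ {y z : 𝓞 ↥(ℚ⟮θ⟯ ⊔ (CyclotomicZp.zpExtension 2).layer 1)}, y - 1 = xA * z → ¬ xA ∣ y := by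
    rintro y z hyz ⟨c, hc⟩
    exact hprime.not_unit (isUnit_of_dvd_one ⟨c - z, by linear_combination hc - hyz⟩)
  have hnb2 : ¬ xA ∣ bA ^ 2 := hone hkap
  have hnμ : ¬ xA ∣ (bA + bA ^ 2 * xA) := hone hkap'
  refine ⟨bA, xA, sA, v, hbAval', rfl, ?_, RbA, RxA, hs, hsA2, hprime, hres, hnb2, hnμ, hPξ, hPψ, hvunit, hv2⟩
  change ξ' * θ' = t'
  exact hξθ

/-! ## §3 The parity of `h(A₁)` -/

set_option maxHeartbeats 800000 in
/-- **`h(ℚ(θ) ⊔ ℚ_1)` is ODD for `θ³ − θ² − 4θ + 2 = 0`** (`ℚ(θ, √2)`, the first cyclotomic layer of the cubic field of discriminant `316`,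
where `2 = 𝔭₁²𝔭₂`): genus theory for `ℚ(θ,√2)/ℚ(θ)` — at most the two dyadic primes ramify, no infinite place, `h(ℚ(θ)) = 1`, and the unit
`ε = 3 + θ − θ²` is not a norm (dyadic certificate `…316Cubic`). KERNEL; matches eng-2's `h(K(√2)) = 1` (CERT-NARROW6).
[cite: Lang1990, Ch. 13 §4, Lemma 4.1 (PDF pp. 203–204)] [cite: NeukirchANT1999, Ch. III (2.6)] [cite: Washington1997, §13.1] -/
theorem odd_classNumber_adjoin_sup_layer_one_d316
    (hθ : aeval θ (Cubic.toPoly ⟨1, ((-1 : ℤ) : ℚ), ((-4 : ℤ) : ℚ), ((2 : ℤ) : ℚ)⟩) = 0) :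
    haveI : FiniteDimensional ℚ ↥ℚ⟮θ⟯ :=
      IntermediateField.adjoin.finiteDimensional ⟨_, Cubic.monic_of_a_eq_one', by rwa [← aeval_def]⟩
    haveI : FiniteDimensional ℚ ↥((CyclotomicZp.zpExtension 2).layer 1) := (CyclotomicZp.zpExtension 2).finiteDimensional_layer_holds 1
    haveI : NumberField ↥(ℚ⟮θ⟯ ⊔ (CyclotomicZp.zpExtension 2).layer 1) := NumberField.mk
    Odd (classNumber ↥(ℚ⟮θ⟯ ⊔ (CyclotomicZp.zpExtension 2).layer 1)) := by
  haveI : FiniteDimensional ℚ ↥ℚ⟮θ⟯ :=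
    IntermediateField.adjoin.finiteDimensional ⟨_, Cubic.monic_of_a_eq_one', by rwa [← aeval_def]⟩
  haveI : FiniteDimensional ℚ ↥((CyclotomicZp.zpExtension 2).layer 1) := (CyclotomicZp.zpExtension 2).finiteDimensional_layer_holds 1
  haveI : NumberField ↥ℚ⟮θ⟯ := NumberField.mk
  haveI : NumberField ↥(ℚ⟮θ⟯ ⊔ (CyclotomicZp.zpExtension 2).layer 1) := NumberField.mk
  obtain ⟨hreal, hfinA, h3⟩ := layer_one_basics_d316 hθ
  haveI := hreal
  haveI : IsTotallyReal ↥ℚ⟮θ⟯ := isTotallyReal_adjoin_d316 hθ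
  obtain ⟨t, ht, ht2⟩ := CyclotomicZp.exists_mem_layer_one_sq_eq_two_zpExtension
  have hKA : ℚ⟮θ⟯ ≤ ℚ⟮θ⟯ ⊔ (CyclotomicZp.zpExtension 2).layer 1 := le_sup_left
  have htA : t ∈ ℚ⟮θ⟯ ⊔ (CyclotomicZp.zpExtension 2).layer 1 := (le_sup_right : (CyclotomicZp.zpExtension 2).layer 1 ≤ _) ht
  set t' : ↥(ℚ⟮θ⟯ ⊔ (CyclotomicZp.zpExtension 2).layer 1) := ⟨t, htA⟩ with ht'def
  have ht'2 : t' ^ 2 = 2 := by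
    apply (algebraMap ↥(ℚ⟮θ⟯ ⊔ (CyclotomicZp.zpExtension 2).layer 1) (AlgebraicClosure ℚ)).injective
    rw [map_pow, map_ofNat]
    exact ht2
  letI : Algebra ↥ℚ⟮θ⟯ ↥(ℚ⟮θ⟯ ⊔ (CyclotomicZp.zpExtension 2).layer 1) := (inclusion hKA).toRingHom.toAlgebra
  have halg : ∀ c : ↥ℚ⟮θ⟯, algebraMap ↥ℚ⟮θ⟯ ↥(ℚ⟮θ⟯ ⊔ (CyclotomicZp.zpExtension 2).layer 1) c = inclusion hKA c := fun _ => rfl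
  haveI : IsScalarTower ℚ ↥ℚ⟮θ⟯ ↥(ℚ⟮θ⟯ ⊔ (CyclotomicZp.zpExtension 2).layer 1) := IsScalarTower.of_algebraMap_eq fun q => ((inclusion hKA).commutes q).symm
  haveI : Module.Finite ↥ℚ⟮θ⟯ ↥(ℚ⟮θ⟯ ⊔ (CyclotomicZp.zpExtension 2).layer 1) := Module.Finite.of_restrictScalars_finite ℚ ↥ℚ⟮θ⟯ _
  have hdeg : Module.finrank ↥ℚ⟮θ⟯ ↥(ℚ⟮θ⟯ ⊔ (CyclotomicZp.zpExtension 2).layer 1) = 2 := by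
    have htower := Module.finrank_mul_finrank ℚ ↥ℚ⟮θ⟯ ↥(ℚ⟮θ⟯ ⊔ (CyclotomicZp.zpExtension 2).layer 1)
    rw [h3, hfinA] at htower
    omega
  haveI : Algebra.IsQuadraticExtension ↥ℚ⟮θ⟯ ↥(ℚ⟮θ⟯ ⊔ (CyclotomicZp.zpExtension 2).layer 1) := ⟨hdeg⟩
  haveI : IsGalois ↥ℚ⟮θ⟯ ↥(ℚ⟮θ⟯ ⊔ (CyclotomicZp.zpExtension 2).layer 1) := inferInstance
  -- `√2 ∉ ℚ(θ)`
  have htK : t' ∉ Set.range (algebraMap ↥ℚ⟮θ⟯ ↥(ℚ⟮θ⟯ ⊔ (CyclotomicZp.zpExtension 2).layer 1)) := by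
    rintro ⟨c, hc⟩
    obtain ⟨ρ, hρK, hρt⟩ := exists_ringHom_sup_layer_one_d316 hθ ht ht2
      (InfinitePlace.embedding_of_isReal (IsTotallyReal.isReal (Classical.arbitrary (InfinitePlace ↥ℚ⟮θ⟯)))) (Real.sqrt 2) (Or.inl rfl)
    obtain ⟨ρ', hρ'K, hρ't⟩ := exists_ringHom_sup_layer_one_d316 hθ ht ht2
      (InfinitePlace.embedding_of_isReal (IsTotallyReal.isReal (Classical.arbitrary (InfinitePlace ↥ℚ⟮θ⟯)))) (-Real.sqrt 2) (Or.inr rfl)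
    have h1 : ρ t' = ρ' t' := by rw [← hc, halg, hρK, hρ'K]
    rw [hρt, hρ't] at h1
    have := sqrt_two_bounds'; linarith [this.1]
  -- `A = ℚ(θ)(√2)` as an algebra
  have htint : IsIntegral ↥ℚ⟮θ⟯ t' := (Algebra.IsIntegral.isIntegral (R := ℚ) t').tower_top
  have hgen : IntermediateField.adjoin ↥ℚ⟮θ⟯ ({t'} : Set ↥(ℚ⟮θ⟯ ⊔ (CyclotomicZp.zpExtension 2).layer 1)) = ⊤ := by
    have h2le : 2 ≤ (minpoly ↥ℚ⟮θ⟯ t').natDegree := (minpoly.two_le_natDegree_iff htint).mpr htK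
    refine IntermediateField.eq_of_le_of_finrank_eq le_top ?_
    rw [IntermediateField.adjoin.finrank htint, IntermediateField.finrank_top', hdeg]
    exact le_antisymm ((minpoly.natDegree_le (A := ↥ℚ⟮θ⟯) (x := t')).trans hdeg.le) h2le
  have hgenA : Algebra.adjoin ↥ℚ⟮θ⟯ ({t'} : Set ↥(ℚ⟮θ⟯ ⊔ (CyclotomicZp.zpExtension 2).layer 1)) = ⊤ := by
    rw [← IntermediateField.adjoin_simple_toSubalgebra_of_isAlgebraic htint.isAlgebraic, hgen, IntermediateField.top_toSubalgebra]
  -- the integer `sA = √2`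
  have hsint : IsIntegral ℤ t' := ⟨X ^ 2 - C 2, monic_X_pow_sub_C _ two_ne_zero, by simp [ht'2]⟩
  set sA : 𝓞 ↥(ℚ⟮θ⟯ ⊔ (CyclotomicZp.zpExtension 2).layer 1) := ⟨t', hsint⟩ with hsAdef
  have hsAval : ((sA : 𝓞 ↥(ℚ⟮θ⟯ ⊔ (CyclotomicZp.zpExtension 2).layer 1)) : ↥(ℚ⟮θ⟯ ⊔ (CyclotomicZp.zpExtension 2).layer 1)) = t' := rfl
  have hsA2 : sA ^ 2 = algebraMap (𝓞 ↥ℚ⟮θ⟯) (𝓞 ↥(ℚ⟮θ⟯ ⊔ (CyclotomicZp.zpExtension 2).layer 1)) 2 := by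
    rw [map_ofNat]
    apply IsFractionRing.injective (𝓞 ↥(ℚ⟮θ⟯ ⊔ (CyclotomicZp.zpExtension 2).layer 1)) ↥(ℚ⟮θ⟯ ⊔ (CyclotomicZp.zpExtension 2).layer 1)
    rw [map_pow, map_ofNat, ← NumberField.RingOfIntegers.coe_eq_algebraMap, hsAval, ht'2]
  -- layer-0 data
  obtain ⟨b, -, hb⟩ := exists_ringOfIntegers_cubic_root (p := -1) (q := -4) (r := 2) hθ
  set eE : (𝓞 ↥ℚ⟮θ⟯)ˣ := (isUnit_eps_d316 ↥ℚ⟮θ⟯ b hb).unit with heEdef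
  have heEb : (eE : 𝓞 ↥ℚ⟮θ⟯) = 3 + b - b ^ 2 := (isUnit_eps_d316 ↥ℚ⟮θ⟯ b hb).unit_spec
  have hK : Odd (classNumber ↥ℚ⟮θ⟯) := by
    rw [NumberField.classNumber, ← Nat.card_eq_fintype_card,
      card_classGroup_adjoin_eq_one_of_forall_cubicField irreducible_cubic_d316p (classNumber_eq_one_of_root_d316p) hθ]
    exact odd_one
  -- the non-norm unit `ε`
  have hne : ∀ a c : ↥ℚ⟮θ⟯, a ^ 2 - 2 * c ^ 2 ≠ ((eE : 𝓞 ↥ℚ⟮θ⟯) : ↥ℚ⟮θ⟯) := by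
    intro a c h
    have hno := not_exists_sq_sub_two_mul_sq_eq_eps_d316 ↥ℚ⟮θ⟯ h3 b hb
    exact hno ⟨a, c, by rw [h, heEb]⟩
  have hs : t' ^ 2 = algebraMap ↥ℚ⟮θ⟯ ↥(ℚ⟮θ⟯ ⊔ (CyclotomicZp.zpExtension 2).layer 1) 2 := by rw [map_ofNat]; exact ht'2
  -- at most the two dyadic primes ramify
  have hram : (∏ᶠ v : HeightOneSpectrum (𝓞 ↥ℚ⟮θ⟯), v.asIdeal.ramificationIdxIn (𝓞 ↥(ℚ⟮θ⟯ ⊔ (CyclotomicZp.zpExtension 2).layer 1))) ∣ 4 := by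
    rw [AmbiguousClass.finprod_ramificationIdxIn_eq_pow_of_prime Nat.prime_two hdeg]
    obtain ⟨u, hunit, htwo, hP₁, hP₂, -, -, -, -⟩ := exists_dyadic_primes_d316 ↥ℚ⟮θ⟯ h3 b hb
    set π₁ : 𝓞 ↥ℚ⟮θ⟯ := b with hπ₁def
    set π₂ : 𝓞 ↥ℚ⟮θ⟯ := b - 1 with hπ₂def
    have hπ₁0 : Ideal.span {π₁} ≠ ⊥ := by
      rw [Ne, Ideal.span_singleton_eq_bot]; intro h0; rw [h0] at htwo; norm_num at htwo
    have hπ₂0 : Ideal.span {π₂} ≠ ⊥ := by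
      rw [Ne, Ideal.span_singleton_eq_bot]; intro h0; rw [h0] at htwo; norm_num at htwo
    set v₁ : HeightOneSpectrum (𝓞 ↥ℚ⟮θ⟯) := ⟨Ideal.span {π₁}, hP₁, hπ₁0⟩ with hv₁
    set v₂ : HeightOneSpectrum (𝓞 ↥ℚ⟮θ⟯) := ⟨Ideal.span {π₂}, hP₂, hπ₂0⟩ with hv₂
    have hsub : {v : HeightOneSpectrum (𝓞 ↥ℚ⟮θ⟯) | v.asIdeal.ramificationIdxIn (𝓞 ↥(ℚ⟮θ⟯ ⊔ (CyclotomicZp.zpExtension 2).layer 1)) ≠ 1} ⊆ {v₁, v₂} := by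
      intro v hv
      rw [Set.mem_setOf_eq] at hv
      -- `2 ∈ v` (else `v` is unramified in `A = ℚ(θ)(√2)`)
      have h2v : (2 : 𝓞 ↥ℚ⟮θ⟯) ∈ v.asIdeal := by
        by_contra h2
        apply hv
        haveI := v.isMaximal
        obtain ⟨Q, hQmax, hQover⟩ := Ideal.exists_maximal_ideal_liesOver_of_isIntegral (S := 𝓞 ↥(ℚ⟮θ⟯ ⊔ (CyclotomicZp.zpExtension 2).layer 1)) v.asIdeal
        haveI := hQmax
        haveI := hQover
        rw [Ideal.ramificationIdxIn_eq_ramificationIdx v.asIdeal Q (↥(ℚ⟮θ⟯ ⊔ (CyclotomicZp.zpExtension 2).layer 1) ≃ₐ[↥ℚ⟮θ⟯] ↥(ℚ⟮θ⟯ ⊔ (CyclotomicZp.zpExtension 2).layer 1))]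
        have hunr : Algebra.IsUnramifiedAt (𝓞 ↥ℚ⟮θ⟯) Q := by
          refine isUnramifiedAt_of_sq_eq hsA2 hgenA Q fun hmem => h2 ?_
          have h8 : algebraMap (𝓞 ↥ℚ⟮θ⟯) (𝓞 ↥(ℚ⟮θ⟯ ⊔ (CyclotomicZp.zpExtension 2).layer 1)) (4 * 2) = 2 * (2 * 2) := by
            rw [map_mul, map_ofNat, map_ofNat]; norm_num
          rw [h8] at hmem
          have h2Q : (2 : 𝓞 ↥(ℚ⟮θ⟯ ⊔ (CyclotomicZp.zpExtension 2).layer 1)) ∈ Q := by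
            rcases (inferInstance : Q.IsPrime).mem_or_mem hmem with h | h
            · exact h
            · exact ((inferInstance : Q.IsPrime).mem_or_mem h).elim id id
          have h2u : (2 : 𝓞 ↥ℚ⟮θ⟯) ∈ Q.under (𝓞 ↥ℚ⟮θ⟯) := by
            rw [Ideal.under_def, Ideal.mem_comap, map_ofNat]; exact h2Q
          rwa [← Ideal.over_def Q v.asIdeal] at h2u
        exact Ideal.ramificationIdx_eq_one_iff.mpr hunr
      -- `π₁ ∈ v ∨ π₂ ∈ v`
      rw [← htwo] at h2v
      have hπ : π₁ ∈ v.asIdeal ∨ π₂ ∈ v.asIdeal := by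
        rcases v.isPrime.mem_or_mem h2v with h | h
        · rcases v.isPrime.mem_or_mem h with hu | hp
          · exact absurd (Ideal.eq_top_of_isUnit_mem _ hu hunit) v.isPrime.ne_top
          · exact Or.inl (v.isPrime.mem_of_pow_mem 2 hp)
        · exact Or.inr h
      simp only [Set.mem_insert_iff, Set.mem_singleton_iff]
      rcases hπ with h | h
      · left
        apply HeightOneSpectrum.ext
        exact ((hP₁.isMaximal hπ₁0).eq_of_le v.isPrime.ne_top ((Ideal.span_singleton_le_iff_mem _).mpr h)).symm
      · right
        apply HeightOneSpectrum.ext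
        exact ((hP₂.isMaximal hπ₂0).eq_of_le v.isPrime.ne_top ((Ideal.span_singleton_le_iff_mem _).mpr h)).symm
    have hle : {v : HeightOneSpectrum (𝓞 ↥ℚ⟮θ⟯) | v.asIdeal.ramificationIdxIn (𝓞 ↥(ℚ⟮θ⟯ ⊔ (CyclotomicZp.zpExtension 2).layer 1)) ≠ 1}.ncard ≤ 2 := by
      refine (Set.ncard_le_ncard hsub (Set.toFinite _)).trans ?_
      exact (Set.ncard_insert_le v₁ {v₂}).trans (by rw [Set.ncard_singleton])
    calc 2 ^ {v : HeightOneSpectrum (𝓞 ↥ℚ⟮θ⟯) | v.asIdeal.ramificationIdxIn (𝓞 ↥(ℚ⟮θ⟯ ⊔ (CyclotomicZp.zpExtension 2).layer 1)) ≠ 1}.ncard ∣ 2 ^ 2 := pow_dvd_pow 2 hle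
      _ = 4 := by norm_num
  exact AmbiguousClass.odd_classNumber_of_quadratic_of_isTotallyReal_of_forall_sq_sub_mul_sq_ne hdeg hram hs htK eE hne hK

end Summit.BirchSwinnertonDyer.BirchSwinnertonDyer.Theorems.AddKatoTwo

end
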